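import Summits.RiemannHypothesis.RiemannHypothesis.Theorems.LiDirichletTrendDefs
import Literature.NumberTheory.LFunctions.DirichletXiPairZeroSum
import HarnessLib

/-!
# PART F‴ (cell rh-li, engine seat rh-li-eng-5 gen 4) — T-D2s `LiDirichletSplit` PROVED (RH-FREE, GRH-FREE)

Ladder RH, row L-D (Dirichlet rows) → PROOF-OF-DATA twin **T-D2s** (`LiDirichletTrendDefs.lean`, theory g7): for every
primitive character `χ` mod `q > 1` and every `n ≥ 1`,

  `liCoeffCharRe χ n = charLiTrend χ n + charLiOsc χ n`,

i.e. the tree's criterion object — Bombieri–Lagarias' absolutely convergent REAL Li coefficient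
`Re λ_χ(n) = Σ'_ρ m_χ(ρ) Re[1 − (1 − 1/ρ)ⁿ]` over the non-trivial zeros of `L(s,χ)` (`LiCriterionDirichlet.lean:95`) — EQUALS
the Taylor-side quantity the certified tables compute: archimedean trend (Li functional of the Gamma factor,
`charLiTrend`) plus arithmetic part (Li functional of `log L(s,χ)`, `charLiOsc`).  This is Li 2004, Thm 2 / (2.3), in real
part, and it is the DICTIONARY that books the `Re λ_χ(n)` and `lt_χ(n)` columns of HOME/data/li_dirichlet_lambda_*.tsv
against `liCoeffCharRe` (DATA.md §J.0 / J.5(i): "the dictionary `T_χ = conj λ_χ` is NOT a tree theorem for χ" — its real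
part now is).

Proof (files `Literature/NumberTheory/LFunctions/DirichletXiPair{Hadamard,Zeros,LogDerivSeries,Multiplicity,ZeroSum}.lean`,
all RH-free): the PAIR `Ξ_χ = ξ(·,χ)ξ(·,χ̄)` is `s ↦ 1−s` symmetric, so its even lift has order `¾ < 1` and the tree's PROVED
genus-zero Hadamard theorem applies (base point `9/4`; `L(½,χ) = 0` not excluded); differentiating the partial-fraction
series of `Ξ_χ'/Ξ_χ` termwise at `s = 1` and double counting the Hadamard pairs against the zeros of `L(s,χ)`, `L(s,χ̄)` with
multiplicity gives `Re (1/(n−1)!) dⁿ/dsⁿ[s^{n−1} log Ξ_χ]_{s=1} = 2·liCoeffCharRe χ n`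
(`DirichletTheta.re_liFunctional_log_xiPair_eq_two_mul`).  THIS FILE does the Taylor side: `ξ'/ξ(s,χ) = ½log(q/π) +
½ψ((s+a)/2) + L′/L(s,χ)` (`logDeriv_dirichletXi_eq` + `logDeriv_Gammaℝ`), `ξ'/ξ(s,χ̄) = conj ξ'/ξ(s̄,χ)`, Leibniz at `s = 1`
and Li's change of variables `s = 1/(1−z)` for the Gamma part (`iteratedDeriv_pow_mul_eq_iteratedDeriv_comp_liMap`), so that
`Re (1/(n−1)!) dⁿ/dsⁿ[s^{n−1} log Ξ_χ]_{s=1} = 2·(charLiTrend χ n + charLiOsc χ n)`.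

**Nothing in this file bears on the truth of RH or GRH**: an unconditional identity between two expressions for the same
number; whether `liCoeffCharRe χ n ≥ 0` for all `n` (⇔ GRH(χ), `LiCriterionDirichlet.lean:194`, RH-EQUIVALENT) is untouched.
bears_on: LADDER-RH L-D (COLUMN 4 LI, Dirichlet rows).
-/

noncomputable section

-- D-0017: `Summit.<S>.<S>.…` is the designed namespace of a single-problem summit.
set_option linter.dupNamespace false

open Complex Filter Topology Set Metric Finset
open scoped ComplexConjugate Nat

namespace Summit.RiemannHypothesis.RiemannHypothesis.Theorems.LiTheory

open Literature.NumberTheory.LFunctions Literature.NumberTheory.LFunctions.DirichletTheta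
open Literature.NumberTheory.LFunctions.LiDirichlet

variable {q : ℕ} [NeZero q] {χ : DirichletCharacter ℂ q}

/-- A point of the open right half-plane is not a pole `−m` of `Γ`. [folklore] -/
private theorem ne_neg_nat_of_re_pos'' {s : ℂ} (hs : 0 < s.re) (m : ℕ) : s ≠ -(m : ℂ) := by
  intro h
  have := congrArg Complex.re h
  simp at this
  linarith [(Nat.cast_nonneg m : (0 : ℝ) ≤ m)]

/-! ## Conjugation: `ξ'/ξ(·, χ̄)` at `s = 1` is the conjugate of `ξ'/ξ(·, χ)` -/

/-- `deriv (s ↦ conj k(conj s)) z = conj (k'(conj z))`, unconditionally. [folklore] -/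
private theorem deriv_conj_conj' (k : ℂ → ℂ) (z : ℂ) :
    deriv (fun s ↦ conj (k (conj s))) z = conj (deriv k (conj z)) := by
  by_cases h : DifferentiableAt ℂ k (conj z)
  · have h1 := h.hasDerivAt.conj_conj
    rw [Complex.conj_conj] at h1
    exact h1.deriv
  · have h2 : ¬DifferentiableAt ℂ (fun s ↦ conj (k (conj s))) z := by
      intro hd
      have h3 := hd.hasDerivAt.conj_conj
      have hg : (conj ∘ (fun s ↦ conj (k (conj s))) ∘ conj) = k := by funext s; simp
      rw [hg] at h3
      exact h h3.differentiableAt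
    rw [deriv_zero_of_not_differentiableAt h, deriv_zero_of_not_differentiableAt h2, map_zero]

/-- `(s ↦ conj k(conj s))^{(n)}(z) = conj (k^{(n)}(conj z))`, unconditionally. [folklore] -/
private theorem iteratedDeriv_conj_conj' (k : ℂ → ℂ) (n : ℕ) (z : ℂ) :
    iteratedDeriv n (fun s ↦ conj (k (conj s))) z = conj (iteratedDeriv n k (conj z)) := by
  induction n generalizing z with
  | zero => simp
  | succ n ih =>
    have e : iteratedDeriv n (fun s ↦ conj (k (conj s))) = fun s ↦ conj (iteratedDeriv n k (conj s)) :=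
      funext ih
    rw [iteratedDeriv_succ, e, iteratedDeriv_succ]
    exact deriv_conj_conj' _ z

/-- `logDeriv` of `s ↦ conj k(conj s)` is `s ↦ conj (logDeriv k (conj s))`. [folklore] -/
private theorem logDeriv_conj_conj' (k : ℂ → ℂ) :
    logDeriv (fun s ↦ conj (k (conj s))) = fun s ↦ conj (logDeriv k (conj s)) := by
  funext s
  rw [logDeriv_apply, logDeriv_apply, deriv_conj_conj', ← map_div₀]

/-- `ξ(s, χ̄) = conj ξ(s̄, χ)` (`χ ≠ 1`). [folklore] -/
private theorem dirichletXi_inv_eq (h1 : χ ≠ 1) :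
    dirichletXi χ⁻¹ = fun s ↦ conj (dirichletXi χ (conj s)) := by
  funext s
  rw [conj_dirichletXi h1, Complex.conj_conj]

/-- **`(ξ'/ξ(·,χ̄))^{(j)}(1) = conj (ξ'/ξ(·,χ))^{(j)}(1)`** (`χ ≠ 1`). [folklore] -/
private theorem iteratedDeriv_logDeriv_dirichletXi_inv (h1 : χ ≠ 1) (j : ℕ) :
    iteratedDeriv j (logDeriv (dirichletXi χ⁻¹)) 1 = conj (iteratedDeriv j (logDeriv (dirichletXi χ)) 1) := by
  rw [dirichletXi_inv_eq h1, logDeriv_conj_conj', iteratedDeriv_conj_conj', map_one]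

/-! ## `(log Ξ_χ)^{(j+1)}(1) = (ξ'/ξ(·,χ))^{(j)}(1) + conj (ξ'/ξ(·,χ))^{(j)}(1)` -/

/-- `ξ(1, χ) ≠ 0` (primitive `χ ≠ 1`). [folklore] -/
private theorem dirichletXi_one_ne_zero (hχ : χ.IsPrimitive) (h1 : χ ≠ 1) : dirichletXi χ 1 ≠ 0 :=
  dirichletXi_ne_zero_of_not_mem_strip hχ h1 (Or.inr (by norm_num))

/-- `logDeriv ξ(·, ψ)` is analytic at `1` for primitive `ψ ≠ 1`. [folklore] -/
private theorem analyticAt_logDeriv_dirichletXi {ψ : DirichletCharacter ℂ q} (hψ : ψ.IsPrimitive) (h1 : ψ ≠ 1) :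
    AnalyticAt ℂ (logDeriv (dirichletXi ψ)) 1 := by
  have han : AnalyticAt ℂ (dirichletXi ψ) 1 := (differentiable_dirichletXi h1).analyticAt 1
  have h : logDeriv (dirichletXi ψ) = fun s ↦ deriv (dirichletXi ψ) s / dirichletXi ψ s := by
    funext s; rw [logDeriv_apply]
  rw [h]
  exact han.deriv.div han (dirichletXi_one_ne_zero hψ h1)

/-- `(log Ξ_χ)^{(j+1)}(1) = (Ξ_χ'/Ξ_χ)^{(j)}(1)` (the principal `log Ξ_χ` is a primitive of `Ξ_χ'/Ξ_χ` near `1`). [folklore] -/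
private theorem iteratedDeriv_succ_log_xiPair_one' (hχ : χ.IsPrimitive) (h1 : χ ≠ 1) (j : ℕ) :
    iteratedDeriv (j + 1) (fun s ↦ Complex.log (xiPair χ s)) 1 = iteratedDeriv j (logDeriv (xiPair χ)) 1 := by
  rw [iteratedDeriv_succ']
  refine Filter.EventuallyEq.iteratedDeriv_eq j ?_
  have hV : ∀ᶠ s in 𝓝 (1 : ℂ), xiPair χ s ∈ slitPlane :=
    (differentiable_xiPair h1).continuous.continuousAt.eventually_mem
      (isOpen_slitPlane.mem_nhds (xiPair_one_mem_slitPlane hχ h1))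
  filter_upwards [hV] with s hs
  rw [((differentiable_xiPair h1 s).hasDerivAt.clog hs).deriv, logDeriv_apply]

/-- **`(Ξ_χ'/Ξ_χ)^{(j)}(1) = Φⱼ + conj Φⱼ`**, `Φⱼ := (ξ'/ξ(·,χ))^{(j)}(1)`: `logDeriv` of a product near a point where both
factors are non-zero, and the conjugation symmetry of `ξ(·,χ̄)`. [folklore] -/
private theorem iteratedDeriv_logDeriv_xiPair (hχ : χ.IsPrimitive) (h1 : χ ≠ 1) (j : ℕ) :
    iteratedDeriv j (logDeriv (xiPair χ)) 1 =
      iteratedDeriv j (logDeriv (dirichletXi χ)) 1 + conj (iteratedDeriv j (logDeriv (dirichletXi χ)) 1) := by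
  have h1' : χ⁻¹ ≠ 1 := inv_ne_one.mpr h1
  have hχ' : χ⁻¹.IsPrimitive := by
    rw [DirichletCharacter.isPrimitive_def, DirichletCharacter.conductor_inv]; exact hχ
  have hev1 : ∀ᶠ s in 𝓝 (1 : ℂ), dirichletXi χ s ≠ 0 :=
    (differentiable_dirichletXi h1).continuous.continuousAt.eventually_ne (dirichletXi_one_ne_zero hχ h1)
  have hev2 : ∀ᶠ s in 𝓝 (1 : ℂ), dirichletXi χ⁻¹ s ≠ 0 :=
    (differentiable_dirichletXi h1').continuous.continuousAt.eventually_ne (dirichletXi_one_ne_zero hχ' h1')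
  have hfe : logDeriv (xiPair χ) =ᶠ[𝓝 1] fun s ↦ logDeriv (dirichletXi χ) s + logDeriv (dirichletXi χ⁻¹) s := by
    filter_upwards [hev1, hev2] with s hs1 hs2
    have hfun : xiPair χ = fun s ↦ dirichletXi χ s * dirichletXi χ⁻¹ s := by funext s; rfl
    rw [hfun, logDeriv_mul s hs1 hs2 (differentiable_dirichletXi h1 s) (differentiable_dirichletXi h1' s)]
  rw [hfe.iteratedDeriv_eq, iteratedDeriv_fun_add (analyticAt_logDeriv_dirichletXi hχ h1).contDiffAt
    (analyticAt_logDeriv_dirichletXi hχ' h1').contDiffAt, iteratedDeriv_logDeriv_dirichletXi_inv h1]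

/-! ## The archimedean primitive `G_χ(s) = (c/2)s + log Γ((s+a)/2)`, `c = log(q/π)` -/

omit [NeZero q] in
/-- `Γ((1+a)/2)` is a positive real (`√π` or `1`), hence in the slit plane. [folklore] -/
private theorem Gamma_half_one_add_parity_mem_slitPlane (χ : DirichletCharacter ℂ q) :
    Complex.Gamma ((1 + (charParity χ : ℂ)) / 2) ∈ slitPlane := by
  have h : ((1 + (charParity χ : ℂ)) / 2) = (((1 + (charParity χ : ℝ)) / 2 : ℝ) : ℂ) := by push_cast; ring
  rw [h, Complex.Gamma_ofReal, mem_slitPlane_iff]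
  left
  rw [Complex.ofReal_re]
  exact Real.Gamma_pos_of_pos (by positivity)

omit [NeZero q] in
/-- Near `s = 1`: `d/ds [(c/2)s + log Γ((s+a)/2)] = c/2 + ½ψ((s+a)/2)`. [folklore] -/
private theorem hasDerivAt_archPrim_eventually (χ : DirichletCharacter ℂ q) (c : ℂ) :
    ∀ᶠ s in 𝓝 (1 : ℂ), HasDerivAt (fun s ↦ c / 2 * s + Complex.log (Complex.Gamma ((s + (charParity χ : ℂ)) / 2)))
      (c / 2 + Complex.digamma ((s + (charParity χ : ℂ)) / 2) / 2) s := by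
  have hw : ContinuousAt (fun s : ℂ ↦ (s + (charParity χ : ℂ)) / 2) 1 := by fun_prop
  have hre1 : (0 : ℝ) < (((1 : ℂ) + (charParity χ : ℂ)) / 2).re := by simp; positivity
  have hre : ∀ᶠ s in 𝓝 (1 : ℂ), 0 < ((s + (charParity χ : ℂ)) / 2).re :=
    hw.eventually ((isOpen_lt continuous_const Complex.continuous_re).mem_nhds hre1)
  have hΓc : ContinuousAt (fun s : ℂ ↦ Complex.Gamma ((s + (charParity χ : ℂ)) / 2)) 1 := by
    refine ContinuousAt.comp (g := Complex.Gamma) ?_ hw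
    exact (Complex.differentiableAt_Gamma _ (fun m ↦
      ne_neg_nat_of_re_pos'' hre1 m)).continuousAt
  have hsl : ∀ᶠ s in 𝓝 (1 : ℂ), Complex.Gamma ((s + (charParity χ : ℂ)) / 2) ∈ slitPlane :=
    hΓc.eventually (isOpen_slitPlane.mem_nhds (Gamma_half_one_add_parity_mem_slitPlane χ))
  filter_upwards [hre, hsl] with s hs hsl'
  have hpole : ∀ m : ℕ, (s + (charParity χ : ℂ)) / 2 ≠ -m := fun m ↦
    ne_neg_nat_of_re_pos'' hs m
  have hΓd : HasDerivAt Complex.Gamma (deriv Complex.Gamma ((s + (charParity χ : ℂ)) / 2))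
      ((s + (charParity χ : ℂ)) / 2) := (Complex.differentiableAt_Gamma _ hpole).hasDerivAt
  have hlin : HasDerivAt (fun s : ℂ ↦ (s + (charParity χ : ℂ)) / 2) (1 / 2) s := by
    simpa using ((hasDerivAt_id s).add_const (charParity χ : ℂ)).div_const 2
  have hcomp := (hΓd.comp s hlin).clog hsl'
  have hl : HasDerivAt (fun s : ℂ ↦ c / 2 * s) (c / 2) s := by simpa using (hasDerivAt_id s).const_mul (c / 2)
  refine (hl.add hcomp).congr_deriv ?_
  simp only [Function.comp_apply, Complex.digamma_def, logDeriv_apply]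
  field_simp

omit [NeZero q] in
/-- `G_χ` is analytic at `1`. [folklore] -/
private theorem analyticAt_archPrim (χ : DirichletCharacter ℂ q) (c : ℂ) :
    AnalyticAt ℂ (fun s ↦ c / 2 * s + Complex.log (Complex.Gamma ((s + (charParity χ : ℂ)) / 2))) 1 := by
  have hd : ∀ᶠ s in 𝓝 (1 : ℂ), DifferentiableAt ℂ
      (fun s ↦ c / 2 * s + Complex.log (Complex.Gamma ((s + (charParity χ : ℂ)) / 2))) s :=
    (hasDerivAt_archPrim_eventually χ c).mono fun s hs ↦ hs.differentiableAt
  obtain ⟨U, hU, hUo, h1U⟩ := _root_.eventually_nhds_iff.1 hd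
  exact DifferentiableOn.analyticAt (s := U) (fun s hs ↦ (hU s hs).differentiableWithinAt) (hUo.mem_nhds h1U)

omit [NeZero q] in
/-- `G_χ^{(j+1)}(1) = (c/2 + ½ψ((·+a)/2))^{(j)}(1)`. [folklore] -/
private theorem iteratedDeriv_succ_archPrim (χ : DirichletCharacter ℂ q) (c : ℂ) (j : ℕ) :
    iteratedDeriv (j + 1) (fun s ↦ c / 2 * s + Complex.log (Complex.Gamma ((s + (charParity χ : ℂ)) / 2))) 1 =
      iteratedDeriv j (fun s ↦ c / 2 + Complex.digamma ((s + (charParity χ : ℂ)) / 2) / 2) 1 := by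
  rw [iteratedDeriv_succ']
  refine Filter.EventuallyEq.iteratedDeriv_eq j ?_
  filter_upwards [hasDerivAt_archPrim_eventually χ c] with s hs
  exact hs.deriv

omit [NeZero q] in
/-- **Li's change of variables for the Gamma factor**: `dⁿ/dsⁿ[s^{n−1} G_χ(s)]_{s=1} = 𝒜_χ^{(n−1)}(0)`
(`(G_χ ∘ liMap)′ = charTrendGen χ` near `0`, `c = log(q/π)`). [folklore] -/
private theorem iteratedDeriv_pow_mul_archPrim (χ : DirichletCharacter ℂ q) (m : ℕ) :
    iteratedDeriv (m + 1) (fun s ↦ s ^ m *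
      ((Real.log ((q : ℝ) / Real.pi) : ℂ) / 2 * s + Complex.log (Complex.Gamma ((s + (charParity χ : ℂ)) / 2)))) 1 =
      iteratedDeriv m (charTrendGen χ) 0 := by
  set c : ℂ := (Real.log ((q : ℝ) / Real.pi) : ℂ) with hc
  have hG := analyticAt_archPrim χ c
  have h := iteratedDeriv_pow_mul_eq_iteratedDeriv_comp_liMap (m + 1) hG
  simp only [Nat.add_sub_cancel] at h
  rw [h, iteratedDeriv_succ']
  refine Filter.EventuallyEq.iteratedDeriv_eq m ?_
  -- `(G ∘ liMap)' z = G'(liMap z) · liMap z ^ 2 = charTrendGen χ z` near `0`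
  have hcont : ContinuousAt liMap 0 := (analyticAt_liMap zero_ne_one).continuousAt
  have hGd := hasDerivAt_archPrim_eventually χ c
  rw [← liMap_zero] at hGd
  filter_upwards [hcont.eventually hGd, eventually_ne_nhds (zero_ne_one : (0 : ℂ) ≠ 1)] with z hz hz1
  rw [(hz.comp z (hasDerivAt_liMap hz1)).deriv, charTrendGen, hc]

/-! ## `ξ'/ξ(·,χ) = G_χ′ + L′/L(·,χ)` near `s = 1` -/

/-- Near `s = 1`: `ξ'/ξ(s, χ) = ½log(q/π) + ½ψ((s+a)/2) + L′/L(s, χ)` (MV (10.19) differentiated; `Γℝ'/Γℝ(w) = −½log π + ½ψ(w/2)`).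
[folklore] -/
private theorem logDeriv_dirichletXi_eventuallyEq (h1 : χ ≠ 1) :
    logDeriv (dirichletXi χ) =ᶠ[𝓝 1] fun s ↦
      ((Real.log ((q : ℝ) / Real.pi) : ℂ) / 2 + Complex.digamma ((s + (charParity χ : ℂ)) / 2) / 2) +
        logDeriv χ.LFunction s := by
  have hq0 : (q : ℝ) ≠ 0 := by exact_mod_cast NeZero.ne q
  have hre : ∀ᶠ s in 𝓝 (1 : ℂ), 0 < s.re := (isOpen_lt continuous_const Complex.continuous_re).mem_nhds (by simp)
  have hL1 : χ.LFunction 1 ≠ 0 := DirichletCharacter.LFunction_ne_zero_of_one_le_re χ (Or.inl h1) (by simp)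
  have hL : ∀ᶠ s in 𝓝 (1 : ℂ), χ.LFunction s ≠ 0 :=
    (DirichletCharacter.differentiable_LFunction h1).continuous.continuousAt.eventually_ne hL1
  filter_upwards [hre, hL] with s hs hLs
  have hpos : 0 < (s + (charParity χ : ℂ)).re := by simp; positivity
  rw [logDeriv_apply, logDeriv_dirichletXi_eq h1 hs hLs,
    logDeriv_Gammaℝ (half_ne_neg_nat_of_re_pos' hpos), ← Complex.ofReal_log Real.pi_pos.le,
    Real.log_div hq0 Real.pi_ne_zero]
  push_cast
  ring

/-- `L′/L(·, χ)` is analytic at `1`. [folklore] -/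
private theorem analyticAt_logDeriv_LFunction (h1 : χ ≠ 1) : AnalyticAt ℂ (logDeriv χ.LFunction) 1 := by
  have han : AnalyticAt ℂ χ.LFunction 1 := (DirichletCharacter.differentiable_LFunction h1).analyticAt 1
  have h : logDeriv χ.LFunction = fun s ↦ deriv χ.LFunction s / χ.LFunction s := by funext s; rw [logDeriv_apply]
  rw [h]
  exact han.deriv.div han (DirichletCharacter.LFunction_ne_zero_of_one_le_re χ (Or.inl h1) (by simp))

omit [NeZero q] in
/-- The Gamma-factor term is analytic at `1`. [folklore] -/
private theorem analyticAt_archTerm (χ : DirichletCharacter ℂ q) (c : ℂ) :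
    AnalyticAt ℂ (fun s ↦ c / 2 + Complex.digamma ((s + (charParity χ : ℂ)) / 2) / 2) 1 := by
  have h := (analyticAt_archPrim χ c).deriv
  have hfe : deriv (fun s ↦ c / 2 * s + Complex.log (Complex.Gamma ((s + (charParity χ : ℂ)) / 2))) =ᶠ[𝓝 1]
      fun s ↦ c / 2 + Complex.digamma ((s + (charParity χ : ℂ)) / 2) / 2 := by
    filter_upwards [hasDerivAt_archPrim_eventually χ c] with s hs
    exact hs.deriv
  exact h.congr hfe

/-- **Derivatives of `ξ'/ξ(·,χ)` at `1`**: `(ξ'/ξ)^{(j)}(1) = G_χ^{(j+1)}(1) + j!·q_j(χ)`, `q_j = charLogDerivCoeff χ j`. [folklore] -/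
private theorem iteratedDeriv_logDeriv_dirichletXi (h1 : χ ≠ 1) (j : ℕ) :
    iteratedDeriv j (logDeriv (dirichletXi χ)) 1 =
      iteratedDeriv (j + 1) (fun s ↦ (Real.log ((q : ℝ) / Real.pi) : ℂ) / 2 * s +
        Complex.log (Complex.Gamma ((s + (charParity χ : ℂ)) / 2))) 1 + (j ! : ℂ) * charLogDerivCoeff χ j := by
  rw [(logDeriv_dirichletXi_eventuallyEq h1).iteratedDeriv_eq,
    iteratedDeriv_fun_add (analyticAt_archTerm χ _).contDiffAt (analyticAt_logDeriv_LFunction h1).contDiffAt,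
    iteratedDeriv_succ_archPrim, charLogDerivCoeff]
  have hj : (j ! : ℂ) ≠ 0 := by exact_mod_cast Nat.factorial_ne_zero j
  field_simp

/-! ## Assembly -/

/-- **T-D2s `LiDirichletSplit` holds (RH-FREE, GRH-FREE).**  For every primitive Dirichlet character `χ` mod `q > 1` and every
`n ≥ 1`:

  `liCoeffCharRe χ n = charLiTrend χ n + charLiOsc χ n`

— Bombieri–Lagarias' real Li coefficient `Σ'_ρ m_χ(ρ) Re[1 − (1 − 1/ρ)ⁿ]` of `L(s, χ)` equals the archimedean trend plus the
arithmetic part of Li 2004 (2.3) (`(1/(n−1)!) dⁿ/dsⁿ[s^{n−1} log ξ(s,χ)]_{s=1}` in real part).  Zero side: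
`DirichletTheta.re_liFunctional_log_xiPair_eq_two_mul` (Hadamard product of the pair `ξ(·,χ)ξ(·,χ̄)`); Taylor side: this file.
[cite: Li2004, Thm 2; BombieriLagarias1999, Thm 1] -/
theorem liDirichletSplit_holds : LiDirichletSplit := by
  intro q inst χ hχ hq n hn
  classical
  have h1 : χ ≠ 1 := ExplicitPsiChar.ne_one_of_isPrimitive hχ hq
  obtain ⟨m, rfl⟩ : ∃ m, n = m + 1 := ⟨n - 1, by omega⟩
  -- zero side
  have hZ := re_liFunctional_log_xiPair_eq_two_mul hχ hq hn
  simp only [Nat.add_sub_cancel] at hZ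
  -- Taylor side: Leibniz at `s = 1`
  have hg : ContDiffAt ℂ (↑(m + 1)) (fun s ↦ Complex.log (xiPair χ s)) 1 :=
    (((differentiable_xiPair h1).analyticAt 1).clog (xiPair_one_mem_slitPlane hχ h1)).contDiffAt
  have hLeib := iteratedDeriv_pow_mul_one_eq_sum (g := fun s ↦ Complex.log (xiPair χ s)) hn hg
  simp only [Nat.add_sub_cancel] at hLeib
  -- the archimedean primitive and its Leibniz expansion
  set c : ℂ := (Real.log ((q : ℝ) / Real.pi) : ℂ) with hc
  set G : ℂ → ℂ := fun s ↦ c / 2 * s + Complex.log (Complex.Gamma ((s + (charParity χ : ℂ)) / 2)) with hGdef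
  have hGan : AnalyticAt ℂ G 1 := analyticAt_archPrim χ c
  have hLeibG := iteratedDeriv_pow_mul_one_eq_sum (g := G) hn hGan.contDiffAt
  simp only [Nat.add_sub_cancel] at hLeibG
  have hGtrend : iteratedDeriv (m + 1) (fun s ↦ s ^ m * G s) 1 = iteratedDeriv m (charTrendGen χ) 0 :=
    iteratedDeriv_pow_mul_archPrim χ m
  -- Φ_j := (ξ'/ξ)^{(j)}(1) = G^{(j+1)}(1) + j! q_j
  set Φ : ℕ → ℂ := fun j ↦ iteratedDeriv j (logDeriv (dirichletXi χ)) 1 with hΦ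
  have hΦj : ∀ j, Φ j = iteratedDeriv (j + 1) G 1 + (j ! : ℂ) * charLogDerivCoeff χ j := fun j ↦
    iteratedDeriv_logDeriv_dirichletXi h1 j
  -- S := Σ_j C(m+1, j+1) (m!/j!) Φ_j = iteratedDeriv m (charTrendGen χ) 0 + m! Σ_j C(m+1,j+1) q_j
  set S : ℂ := ∑ j ∈ Finset.range (m + 1), ((m + 1).choose (j + 1) : ℂ) * ((m ! : ℂ) / (j ! : ℂ)) * Φ j with hS
  have hm0 : (m ! : ℂ) ≠ 0 := by exact_mod_cast Nat.factorial_ne_zero m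
  have hSval : S = iteratedDeriv m (charTrendGen χ) 0 +
      (m ! : ℂ) * ∑ j ∈ Finset.range (m + 1), ((m + 1).choose (j + 1) : ℂ) * charLogDerivCoeff χ j := by
    rw [hS, ← hGtrend, hLeibG, Finset.mul_sum, ← Finset.sum_add_distrib]
    refine Finset.sum_congr rfl fun j _ ↦ ?_
    rw [hΦj j]
    have hj : (j ! : ℂ) ≠ 0 := by exact_mod_cast Nat.factorial_ne_zero j
    field_simp
  -- D = (S + conj S)/m!
  have hD : iteratedDeriv (m + 1) (fun s ↦ s ^ m * Complex.log (xiPair χ s)) 1 = S + conj S := by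
    rw [hLeib, hS, map_sum, ← Finset.sum_add_distrib]
    refine Finset.sum_congr rfl fun j _ ↦ ?_
    rw [iteratedDeriv_succ_log_xiPair_one' hχ h1, iteratedDeriv_logDeriv_xiPair hχ h1 j]
    simp only [map_mul, map_div₀, map_natCast, hΦ]
    ring
  -- real parts
  have hre : (iteratedDeriv (m + 1) (fun s ↦ s ^ m * Complex.log (xiPair χ s)) 1 / (m ! : ℂ)).re =
      2 * (S / (m ! : ℂ)).re := by
    rw [hD, Complex.add_conj, ← Complex.ofReal_natCast, Complex.div_ofReal_re, Complex.div_ofReal_re,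
      Complex.ofReal_re]
    ring
  have hSre : (S / (m ! : ℂ)).re = charLiTrend χ (m + 1) + charLiOsc χ (m + 1) := by
    have e1 : charLiTrend χ (m + 1) = (iteratedDeriv m (charTrendGen χ) 0 / (m ! : ℂ)).re := by
      simp only [charLiTrend, Nat.add_sub_cancel]
    have e2 : charLiOsc χ (m + 1) =
        (∑ j ∈ Finset.range (m + 1), ((m + 1).choose (j + 1) : ℂ) * charLogDerivCoeff χ j).re := by
      simp only [charLiOsc, Complex.re_sum, Complex.mul_re, Complex.natCast_re, Complex.natCast_im, zero_mul,
        sub_zero]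
    rw [e1, e2, hSval, add_div, mul_div_cancel_left₀ _ hm0, Complex.add_re]
  rw [hre, hSre] at hZ
  linarith

end Summit.RiemannHypothesis.RiemannHypothesis.Theorems.LiTheory

end
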